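import Literature.Probability.RandomPlanarGeometry.OneSidedExcursionHulls
import Literature.Probability.RandomPlanarGeometry.RestrictionConfigEvents
import Literature.Probability.RandomPlanarGeometry.LoewnerSemigroup
import Literature.Probability.RandomPlanarGeometry.OneSidedRestriction
import Mathlib.MeasureTheory.MeasurableSpace.CountablyGenerated
import HarnessLib

/-!
# The cloud of hung two-sided restriction samples (Lawler 2005, §9.2): hung sets, hitting events, their intensity

Topic `Probability/RandomPlanarGeometry`. Piece 3 (first half) of a construction of the
right-sided restriction measures `P⁺_β`, `β > 0`, of Lawler–Schramm–Werner, *Conformal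
restriction: the chordal case* (2003) §8 (**[LSW]**), following the "alternative, simpler method"
of

* G. F. Lawler, *Conformally Invariant Processes in the Plane*, AMS (2005) (**[Law05]**), §9.2,
  p. 220: "Let `μ` denote the excursion measure in `ℍ` restricted to excursions that begin and
  end at `(−∞, 0]`. We can write `μ = ∫₋∞⁰∫₋∞⁰ μ_ℍ(x₁, x₂) dx₁ dx₂` […] Lemma 9.12. If `A ∈ 𝒬₊`,
  then `|μ(A)| < ∞`. […] If `λ > 0`, we can take a Poissonian realization from the measure `μ`.
  Let `K_λ` denote the element of `𝒥₊` obtained by 'left-filling' in the union of all curves in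
  the realization. The previous lemma shows that the probability that this realization avoids
  `A ∈ 𝒬₊` is `exp{−λ|μ(A)|} > 0`. Proposition 9.13. There is a `c` such that […] `K_λ` has the
  distribution `P⁺_{cλ}`", which is the construction behind "The construction above shows that
  `q(α) ∈ (0, 1)`" in the proof of [Law05] Cor. 9.11 (= [LSW] Cor. 8.6).

Here the role of the excursion law `μ^#_ℍ(x₁, x₂)` is played by ANY two-sided restriction
measure `P` of exponent `1` on `Ω` ([LSW] Def. 3.1/3.4; in [Law05] `P_1` is the filled Brownian
excursion, Thm. 9.? / [LSW] p. 5 result 3), hung between `x' = min(x, y)` and `y' = max(x, y)`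
by the Möbius map `m_{x',y'}` of `OneSidedExcursionHulls` after a dilation by `a⁻¹`,
`a ∈ (0, 1)` (the extra dilation parameter costs nothing — `Φ'_{aB}(0) = Φ'_B(0)` — and makes
every point of the left quadrant reachable by hung samples, which is used for the positivity
`P⁺_β{i ∈ K} > 0` in the sibling file). A cloud point is `e = ((x, y), a, K)`; its **hung set**
is `m_{x',y'}(a⁻¹K) ⊆ ℍ` (`hungSet`), which hits a `+`-hull `A` iff `K` hits the `*`-hull
`a · m_{x',y'}⁻¹(A)` (`hungSet_disjoint_iff`); the **intensity** of the cloud of exponent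
`β > 0` is `Λ_β = [β (x − y)⁻² dx dy on (−∞,0)²] ⊗ [da on (0,1)] ⊗ P` (`cloudIntensity`).
Contents (all PROVED):

* `RestrictionConfig.countablySeparated`, `RestrictionConfig.measurableSet_diagonal` — the
  avoidance σ-field of `Ω` separates points countably (dyadic hulls,
  `RestrictionConfig.exists_dyadicUnion_isStarHull_hpFill`), so the diagonal of the state space
  is measurable (Kingman's standing hypothesis);
* `hitSet A` — the event "the hung set hits `A`", and its measurability in the product σ-field
  (`measurableSet_hitSet`: its complement "`K` misses the compact `a · m⁻¹(A)`" is detected by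
  countably many of the tree's `missNear` events);
* `cloudIntensity_hitSet` — **`Λ_β(hit A) = β · (−log Φ'_A(0))`** for `A ∈ 𝒬₊` nonempty
  ([Law05] Lemma 9.12 with the constant identified): the `P`-probability that the hung sample
  hits `A` is `1 − Φ'_{m⁻¹(A)}(0)` (`IsRestrictionMeasure.measure_avoid_excHull`), and the mass
  identity of `OneSidedExcursionHulls` (`IsPlusHull.setLIntegral_prod_one_sub_excDeriv`)
  integrates it;
* `closure_hungSet_subset` — a hung set is closed in `ℍ` up to its two feet `x'`, `y'` on
  `(−∞, 0)`; `coverHull n` — `+`-hulls covering `ℍ ∪ (0, ∞)` (for the local finiteness of the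
  cloud in the sibling file).

No new named fact (Prop definition) is introduced.
-/

noncomputable section

open Set Filter Topology Complex MeasureTheory Metric
open UpperHalfPlane (upperHalfPlaneSet)
open scoped ComplexConjugate ENNReal Pointwise

namespace Literature.Probability.RandomPlanarGeometry

/-! ### The avoidance σ-field of `Ω` is countably separated; measurable diagonal -/

namespace RestrictionConfig

/-- `cl K = K ∪ {0}` for `K ∈ Ω`: the closure of a configuration adds only the origin
(`cl K ∩ ℍ = K`, `cl K ∩ ℝ = {0}`, `cl K ⊆ ℍ̄`). [cite: LawlerSchrammWerner2003Restriction, Def. 3.1 (p. 10)] -/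
theorem closure_eq_union_zero (K : RestrictionConfig) : closure (K : Set ℂ) = (K : Set ℂ) ∪ {0} := by
  apply Subset.antisymm
  · intro z hz
    have him : 0 ≤ z.im := K.closure_subset_setOf_im_nonneg hz
    rcases him.eq_or_lt with h | h
    · have hzr : z ∈ closure (K : Set ℂ) ∩ range ((↑) : ℝ → ℂ) := ⟨hz, z.re, Complex.ext (by simp) (by simp [← h])⟩
      rw [K.closure_inter_range_ofReal] at hzr
      exact Or.inr hzr
    · exact Or.inl (by rw [← K.closure_inter_eq]; exact ⟨hz, h⟩)
  · rintro z (hz | rfl)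
    · exact subset_closure hz
    · exact K.zero_mem_closure

open Classical in
/-- **The avoidance σ-field of `Ω` separates points countably**: the avoidance events of the
`*`-hulls which are fills of finite unions of dyadic squares distinguish any two configurations
(if `w ∈ K ∖ K'`, a small closed disc about `w ∈ ℍ` misses `cl K' = K' ∪ {0}` and
`RestrictionConfig.exists_dyadicUnion_isStarHull_hpFill` gives a dyadic `*`-hull through `w`
avoided by `K'`). [folklore] -/
theorem countablySeparated : MeasurableSpace.CountablySeparated RestrictionConfig := by
  set f : ℕ × Finset (ℤ × ℤ) → Set RestrictionConfig := fun nF ↦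
    if IsStarHull (hpFill (dyadicUnion nF.1 nF.2)) then avoid (hpFill (dyadicUnion nF.1 nF.2)) else ∅
    with hf
  have hfmeas : ∀ nF, MeasurableSet (f nF) := fun nF ↦ by
    simp only [hf]
    split_ifs with h
    · exact measurableSet_avoid h
    · exact MeasurableSet.empty
  refine ⟨⟨range f, countable_range _, ?_, fun K _ K' _ h ↦ ?_⟩⟩
  · rintro _ ⟨nF, rfl⟩
    exact hfmeas nF
  · have key : ∀ K K' : RestrictionConfig, (∀ s ∈ range f, K ∈ s ↔ K' ∈ s) → (K' : Set ℂ) ⊆ K := by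
      intro K K' hKK' w hwK'
      by_contra hwK
      -- a closed disc about `w ∈ ℍ` missing `cl K = K ∪ {0}`
      have hwH : w ∈ upperHalfPlaneSet := K'.subset_upperHalfPlaneSet hwK'
      have hwcl : w ∉ closure (K : Set ℂ) := by
        rw [K.closure_eq_union_zero]
        rintro (h | h)
        · exact hwK h
        · rw [mem_singleton_iff] at h
          rw [h] at hwH
          simp [upperHalfPlaneSet] at hwH
      obtain ⟨ε, hε, hball⟩ := Metric.mem_nhds_iff.1 (isClosed_closure.isOpen_compl.mem_nhds hwcl)
      have hdisj : Disjoint (closedBall w (ε / 2)) (closure (K : Set ℂ)) :=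
        Set.disjoint_left.2 fun u hu huK ↦ hball (closedBall_subset_ball (by linarith) hu) huK
      obtain ⟨n, F, hsub, hstar, hKdisj⟩ := K.exists_dyadicUnion_isStarHull_hpFill (by linarith) hdisj
      have hs : f (n, F) = avoid (hpFill (dyadicUnion n F)) := if_pos hstar
      have h1 : K ∈ f (n, F) := by
        rw [hs, mem_avoid]
        exact hKdisj
      have h2 : K' ∉ f (n, F) := by
        rw [hs, mem_avoid]
        intro hd
        exact Set.disjoint_left.1 hd hwK'
          (inter_subset_hpFill _ ⟨hsub (mem_closedBall_self (by linarith)), hwH⟩)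
      exact h2 ((hKK' _ ⟨(n, F), rfl⟩).1 h1)
    exact Subtype.ext (Subset.antisymm (key K' K fun s hs ↦ (h s hs).symm) (key K K' h))

/-- **The diagonal of `Ω × Ω` is measurable** (a countably separated space embeds measurably
into the Cantor space). [folklore] -/
theorem measurableSet_diagonal : MeasurableSet (Set.diagonal RestrictionConfig) := by
  haveI := countablySeparated
  obtain ⟨f, hf, hinj⟩ := MeasurableSpace.measurable_injection_nat_bool_of_countablySeparated RestrictionConfig
  have h : Set.diagonal RestrictionConfig = ⋂ n, {p : RestrictionConfig × RestrictionConfig | f p.1 n = f p.2 n} := by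
    ext ⟨K, K'⟩
    simp only [mem_diagonal_iff, mem_iInter, mem_setOf_eq]
    exact ⟨fun h n ↦ by rw [h], fun h ↦ hinj (funext h)⟩
  rw [h]
  refine MeasurableSet.iInter fun n ↦ measurableSet_eq_fun ?_ ?_
  · exact (measurable_pi_apply n).comp (hf.comp measurable_fst)
  · exact (measurable_pi_apply n).comp (hf.comp measurable_snd)

end RestrictionConfig

/-- **The diagonal of the state space `((ℝ × ℝ) × ℝ) × Ω` of the cloud is measurable.** [folklore] -/
theorem measurableSet_diagonal_cloudSpace :
    MeasurableSet (Set.diagonal (((ℝ × ℝ) × ℝ) × RestrictionConfig)) := by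
  have h : Set.diagonal (((ℝ × ℝ) × ℝ) × RestrictionConfig) =
      (fun p : (((ℝ × ℝ) × ℝ) × RestrictionConfig) × (((ℝ × ℝ) × ℝ) × RestrictionConfig) ↦ (p.1.1, p.2.1)) ⁻¹'
          Set.diagonal ((ℝ × ℝ) × ℝ) ∩
        (fun p : (((ℝ × ℝ) × ℝ) × RestrictionConfig) × (((ℝ × ℝ) × ℝ) × RestrictionConfig) ↦ (p.1.2, p.2.2)) ⁻¹'
          Set.diagonal RestrictionConfig := by
    ext ⟨⟨p, K⟩, ⟨p', K'⟩⟩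
    simp [Prod.ext_iff]
  rw [h]
  exact ((measurableSet_diagonal : MeasurableSet (Set.diagonal ((ℝ × ℝ) × ℝ))).preimage (by fun_prop)).inter
    (RestrictionConfig.measurableSet_diagonal.preimage (by fun_prop))

/-! ### Hung sets: the Möbius image of a dilated configuration -/

/-- The parameter square `(−∞, 0)²` of the feet. [folklore] -/
def feetSquare : Set (ℝ × ℝ) := Iio 0 ×ˢ Iio 0

/-- The good parameters: feet in `(−∞, 0)²` off the diagonal, dilation in `(0, 1)`. [folklore] -/
def goodParams : Set ((ℝ × ℝ) × ℝ) := {q | q.1 ∈ feetSquare ∧ q.1.1 ≠ q.1.2 ∧ q.2 ∈ Ioo (0 : ℝ) 1}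

/-- The feet square is measurable. [folklore] -/
theorem measurableSet_feetSquare : MeasurableSet feetSquare := measurableSet_Iio.prod measurableSet_Iio

/-- The feet square is open. [folklore] -/
theorem isOpen_feetSquare : IsOpen feetSquare := isOpen_Iio.prod isOpen_Iio

/-- The good parameter set is measurable. [folklore] -/
theorem measurableSet_goodParams : MeasurableSet goodParams := by
  refine (measurableSet_feetSquare.preimage measurable_fst).inter ((MeasurableSet.compl ?_).inter
    (measurableSet_Ioo.preimage measurable_snd))
  exact measurableSet_eq_fun (measurable_fst.comp measurable_fst) (measurable_snd.comp measurable_fst)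

/-- **The hung set of a cloud point** `e = ((x, y), a, K)`: `m_{x',y'}(a⁻¹ K)`, `x' = min(x, y)`,
`y' = max(x, y)` — the configuration `K` (from `0` to `∞`) dilated by `a⁻¹` and hung between the
feet `x' ≤ y'` of `(−∞, 0)` ([Law05] §9.2: an excursion "from `x₁` to `x₂`"). [cite: Lawler2005, §9.2 (p. 220)] -/
def hungSet (e : ((ℝ × ℝ) × ℝ) × RestrictionConfig) : Set ℂ :=
  excMap (min e.1.1.1 e.1.1.2) (max e.1.1.1 e.1.1.2) '' (e.1.2⁻¹ • (e.2 : Set ℂ))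

/-- **The hull seen by the hung sample**: `a · m_{x',y'}⁻¹(A)`. [folklore] -/
def hungHull (q : (ℝ × ℝ) × ℝ) (A : Set ℂ) : Set ℂ :=
  q.2 • excHull (min q.1.1 q.1.2) (max q.1.1 q.1.2) A

section Hung

variable {A : Set ℂ}

/-- For good parameters, `x' < y' < 0` and `0 < a`. [folklore] -/
theorem goodParams_lt {q : (ℝ × ℝ) × ℝ} (hq : q ∈ goodParams) :
    min q.1.1 q.1.2 < max q.1.1 q.1.2 ∧ max q.1.1 q.1.2 < 0 ∧ 0 < q.2 ∧ q.2 < 1 :=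
  ⟨min_lt_max.2 hq.2.1, max_lt hq.1.1 hq.1.2, hq.2.2.1, hq.2.2.2⟩

/-- A hung set lies in the open upper half-plane. [folklore] -/
theorem hungSet_subset_upperHalfPlaneSet {e : ((ℝ × ℝ) × ℝ) × RestrictionConfig} (he : e.1 ∈ goodParams) :
    hungSet e ⊆ upperHalfPlaneSet := by
  obtain ⟨hxy, -, ha, -⟩ := goodParams_lt he
  rintro _ ⟨z, hz, rfl⟩
  refine excMap_mem_upperHalfPlaneSet hxy ?_
  obtain ⟨k, hk, rfl⟩ := hz
  show 0 < (e.1.2⁻¹ • k).im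
  rw [Complex.real_smul, Complex.mul_im, Complex.ofReal_re, Complex.ofReal_im]
  simpa using mul_pos (inv_pos.2 ha) (show 0 < k.im from e.2.subset_upperHalfPlaneSet hk)

/-- **For good parameters, `a · m⁻¹(A) ∈ 𝒬*`** for a `+`-hull `A`. [folklore] -/
theorem isStarHull_hungHull (hA : IsPlusHull A) {q : (ℝ × ℝ) × ℝ} (hq : q ∈ goodParams) :
    IsStarHull (hungHull q A) := by
  obtain ⟨hxy, hy, ha, -⟩ := goodParams_lt hq
  exact (hA.isStarHull_excHull hxy hy).smul ha

/-- **The hung set misses `A` iff `K` misses `a · m⁻¹(A)`** (`m` is a bijection near `A` and on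
`ℍ`). [folklore] -/
theorem hungSet_disjoint_iff (hA : IsPlusHull A) {e : ((ℝ × ℝ) × ℝ) × RestrictionConfig} (he : e.1 ∈ goodParams) :
    Disjoint (hungSet e) A ↔ Disjoint (e.2 : Set ℂ) (hungHull e.1 A) := by
  obtain ⟨hxy, hy, ha, -⟩ := goodParams_lt he
  set x' := min e.1.1.1 e.1.1.2 with hx'
  set y' := max e.1.1.1 e.1.1.2 with hy'
  have ha0 : e.1.2 ≠ 0 := ha.ne'
  rw [hungSet, hungHull, excHull, Set.disjoint_left, Set.disjoint_left]
  constructor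
  · intro h k hk hkB
    -- `k = a • m⁻¹(w)`, `w ∈ A`; then `m(a⁻¹ k) = w ∈ A` lies in the hung set
    obtain ⟨b, ⟨w, hw, rfl⟩, rfl⟩ := hkB
    have hmem : excMap x' y' (e.1.2⁻¹ • (e.1.2 • excInv x' y' w)) ∈ excMap x' y' '' (e.1.2⁻¹ • (e.2 : Set ℂ)) :=
      ⟨_, Set.smul_mem_smul_set hk, rfl⟩
    rw [smul_smul, inv_mul_cancel₀ ha0, one_smul, excMap_excInv hxy.ne (hA.ne_pole hy hw)] at hmem
    exact h hmem hw
  · intro h w hw hwA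
    obtain ⟨z, hz, rfl⟩ := hw
    obtain ⟨k, hk, rfl⟩ := hz
    -- `m(a⁻¹ k) ∈ A` forces `a⁻¹ k ∈ m⁻¹(A)`, i.e. `k ∈ a • m⁻¹(A)`
    have hk1 : e.1.2⁻¹ • k ≠ (-1 : ℂ) := by
      have : e.1.2⁻¹ • k ∈ upperHalfPlaneSet := by
        show 0 < (e.1.2⁻¹ • k).im
        rw [Complex.real_smul, Complex.mul_im, Complex.ofReal_re, Complex.ofReal_im]
        simpa using mul_pos (inv_pos.2 ha) (show 0 < k.im from e.2.subset_upperHalfPlaneSet hk)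
      exact ne_neg_one_of_mem_upperHalfPlaneSet this
    refine h hk ⟨e.1.2⁻¹ • k, ⟨excMap x' y' (e.1.2⁻¹ • k), hwA, excInv_excMap hxy.ne hk1⟩, ?_⟩
    show e.1.2 • (e.1.2⁻¹ • k) = k
    rw [smul_smul, mul_inv_cancel₀ ha0, one_smul]

end Hung

/-! ### A hung set is closed up to its feet -/

section Closure

/-- **`cl(hung set) ⊆ hung set ∪ {x', y'}`**: `m⁻¹` is continuous off its pole `y'`, and pulls a
limit point `w ≠ y'` of `m(a⁻¹K)` back to a point of `cl(a⁻¹K) = a⁻¹K ∪ {0}`, so that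
`w ∈ m(a⁻¹K)` or `w = m(0) = x'`. [folklore] -/
theorem closure_hungSet_subset {e : ((ℝ × ℝ) × ℝ) × RestrictionConfig} (he : e.1 ∈ goodParams) :
    closure (hungSet e) ⊆ hungSet e ∪ {((min e.1.1.1 e.1.1.2 : ℝ) : ℂ), ((max e.1.1.1 e.1.1.2 : ℝ) : ℂ)} := by
  obtain ⟨hxy, hy, ha, -⟩ := goodParams_lt he
  set x' := min e.1.1.1 e.1.1.2 with hx'
  set y' := max e.1.1.1 e.1.1.2 with hy'
  set T : Set ℂ := e.1.2⁻¹ • (e.2 : Set ℂ) with hT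
  have ha0 : e.1.2⁻¹ ≠ 0 := inv_ne_zero ha.ne'
  have hTH : T ⊆ upperHalfPlaneSet := by
    rintro _ ⟨k, hk, rfl⟩
    show 0 < (e.1.2⁻¹ • k).im
    rw [Complex.real_smul, Complex.mul_im, Complex.ofReal_re, Complex.ofReal_im]
    simpa using mul_pos (inv_pos.2 ha) (show 0 < k.im from e.2.subset_upperHalfPlaneSet hk)
  have hclT : closure T = T ∪ {0} := by
    rw [hT, closure_smul₀' ha0, e.2.closure_eq_union_zero, Set.smul_set_union, Set.smul_set_singleton, smul_zero]
  intro w hw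
  by_cases hwy : w = y'
  · exact Or.inr (Or.inr hwy)
  -- `m⁻¹(w) ∈ cl(m⁻¹(hung set)) = cl T`
  have hcont : ContinuousAt (excInv x' y') w := continuousAt_excInv hwy
  have himg : excInv x' y' '' hungSet e = T := by
    rw [hungSet, ← hx', ← hy', ← hT, Set.image_image]
    refine Subset.antisymm ?_ ?_
    · rintro _ ⟨t, ht, rfl⟩
      show excInv x' y' (excMap x' y' t) ∈ T
      rwa [excInv_excMap hxy.ne (ne_neg_one_of_mem_upperHalfPlaneSet (hTH ht))]
    · intro t ht
      exact ⟨t, ht, excInv_excMap hxy.ne (ne_neg_one_of_mem_upperHalfPlaneSet (hTH ht))⟩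
  have hmem : excInv x' y' w ∈ closure T := by
    rw [← himg]
    exact hcont.continuousWithinAt.mem_closure_image hw
  rw [hclT] at hmem
  rcases hmem with h | h
  · -- `w = m(m⁻¹ w) ∈ m(T)`
    left
    rw [hungSet, ← hx', ← hy', ← hT]
    exact ⟨_, h, excMap_excInv hxy.ne hwy⟩
  · -- `m⁻¹(w) = 0` forces `w = x'`
    right; left
    rw [mem_singleton_iff, excInv, div_eq_zero_iff] at h
    rcases h with h | h
    · exact (sub_eq_zero.1 h).symm
    · exact absurd (sub_eq_zero.1 h) hwy

/-- The feet of a good parameter lie on the nonpositive axis. [folklore] -/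
theorem feet_mem_nonposAxis {q : (ℝ × ℝ) × ℝ} (hq : q ∈ goodParams) :
    ((min q.1.1 q.1.2 : ℝ) : ℂ) ∈ nonposAxis ∧ ((max q.1.1 q.1.2 : ℝ) : ℂ) ∈ nonposAxis := by
  obtain ⟨hxy, hy, -, -⟩ := goodParams_lt hq
  exact ⟨⟨_, mem_Iic.2 (hxy.trans hy).le, rfl⟩, ⟨_, mem_Iic.2 hy.le, rfl⟩⟩

end Closure

/-! ### `+`-hulls covering `ℍ ∪ (0, ∞)` -/

section Cover

/-- The compact sets `R_n = {|re| ≤ n+1, 1/(n+1) ≤ im ≤ n+1} ∪ {1/(n+1) ≤ re ≤ n+1, 0 ≤ im ≤ n+1}`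
(a floating rectangle with a leg down to the positive axis), which exhaust `ℍ ∪ (0, ∞)` and miss
`(−∞, 0]`. [folklore] -/
def coverRect (n : ℕ) : Set ℂ :=
  {z : ℂ | |z.re| ≤ n + 1 ∧ 1 / ((n : ℝ) + 1) ≤ z.im ∧ z.im ≤ n + 1} ∪
    {z : ℂ | 1 / ((n : ℝ) + 1) ≤ z.re ∧ z.re ≤ n + 1 ∧ 0 ≤ z.im ∧ z.im ≤ n + 1}

/-- **The covering `+`-hulls** `A_n = hpFill R_n`. [folklore] -/
def coverHull (n : ℕ) : Set ℂ := hpFill (coverRect n)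

/-- `R_n` is closed. [folklore] -/
theorem isClosed_coverRect (n : ℕ) : IsClosed (coverRect n) := by
  unfold coverRect
  refine IsClosed.union ?_ ?_
  · exact (isClosed_le (continuous_abs.comp Complex.continuous_re) continuous_const).inter
      ((isClosed_le continuous_const Complex.continuous_im).inter (isClosed_le Complex.continuous_im continuous_const))
  · exact (isClosed_le continuous_const Complex.continuous_re).inter ((isClosed_le Complex.continuous_re continuous_const).inter
      ((isClosed_le continuous_const Complex.continuous_im).inter (isClosed_le Complex.continuous_im continuous_const)))

/-- `R_n` is bounded. [folklore] -/
theorem isBounded_coverRect (n : ℕ) : Bornology.IsBounded (coverRect n) := by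
  refine (Metric.isBounded_closedBall (x := (0 : ℂ)) (r := 2 * ((n : ℝ) + 1))).subset ?_
  have hn : (0 : ℝ) ≤ n := n.cast_nonneg
  rintro z (⟨h1, h2, h3⟩ | ⟨h1, h2, h3, h4⟩)
  · rw [Metric.mem_closedBall, dist_zero_right]
    refine (Complex.norm_le_abs_re_add_abs_im z).trans ?_
    have : |z.im| = z.im := abs_of_nonneg (le_trans (by positivity) h2)
    rw [this]
    linarith
  · rw [Metric.mem_closedBall, dist_zero_right]
    refine (Complex.norm_le_abs_re_add_abs_im z).trans ?_
    rw [abs_of_nonneg (le_trans (by positivity) h1), abs_of_nonneg h3]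
    linarith

/-- `R_n` misses the nonpositive axis. [folklore] -/
theorem disjoint_coverRect_nonposAxis (n : ℕ) : Disjoint (coverRect n) nonposAxis := by
  refine Set.disjoint_left.2 fun z hz hzn ↦ ?_
  rw [mem_nonposAxis_iff] at hzn
  have hpos : (0 : ℝ) < 1 / ((n : ℝ) + 1) := by positivity
  rcases hz with ⟨-, h2, -⟩ | ⟨h1, -, -, -⟩
  · linarith [hzn.1]
  · linarith [hzn.2]

/-- `R_n ∪ {im ≤ 0}` is connected (both pieces of `R_n` are convex, the rectangle meets the leg
at `(1, 1)·`-type points and the leg meets the lower half-plane at `(1, 0)`). [folklore] -/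
theorem isConnected_coverRect_union (n : ℕ) : IsConnected (coverRect n ∪ {z : ℂ | z.im ≤ 0}) := by
  have hn : (0 : ℝ) ≤ n := n.cast_nonneg
  have hinv : 1 / ((n : ℝ) + 1) ≤ 1 := by
    rw [div_le_one (by positivity)]
    linarith
  -- the two convex pieces
  have hc1 : Convex ℝ {z : ℂ | |z.re| ≤ n + 1 ∧ 1 / ((n : ℝ) + 1) ≤ z.im ∧ z.im ≤ n + 1} := by
    have : {z : ℂ | |z.re| ≤ n + 1 ∧ 1 / ((n : ℝ) + 1) ≤ z.im ∧ z.im ≤ n + 1} =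
        ({z : ℂ | z.re ≤ n + 1} ∩ {z : ℂ | -(n + 1 : ℝ) ≤ z.re}) ∩ ({z : ℂ | 1 / ((n : ℝ) + 1) ≤ z.im} ∩ {z : ℂ | z.im ≤ n + 1}) := by
      ext z
      simp only [mem_setOf_eq, mem_inter_iff, abs_le]
      tauto
    rw [this]
    exact ((convex_halfSpace_re_le _).inter (convex_halfSpace_re_ge _)).inter
      ((convex_halfSpace_im_ge _).inter (convex_halfSpace_im_le _))
  have hc2 : Convex ℝ {z : ℂ | 1 / ((n : ℝ) + 1) ≤ z.re ∧ z.re ≤ n + 1 ∧ 0 ≤ z.im ∧ z.im ≤ n + 1} := by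
    have : {z : ℂ | 1 / ((n : ℝ) + 1) ≤ z.re ∧ z.re ≤ n + 1 ∧ 0 ≤ z.im ∧ z.im ≤ n + 1} =
        {z : ℂ | 1 / ((n : ℝ) + 1) ≤ z.re} ∩ ({z : ℂ | z.re ≤ n + 1} ∩ ({z : ℂ | 0 ≤ z.im} ∩ {z : ℂ | z.im ≤ n + 1})) := by
      ext z
      simp only [mem_setOf_eq, mem_inter_iff]
    rw [this]
    exact (convex_halfSpace_re_ge _).inter ((convex_halfSpace_re_le _).inter
      ((convex_halfSpace_im_ge _).inter (convex_halfSpace_im_le _)))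
  have hc3 : Convex ℝ {z : ℂ | z.im ≤ 0} := convex_halfSpace_im_le 0
  -- common points
  have h11 : (1 : ℂ) + Complex.I ∈ {z : ℂ | |z.re| ≤ n + 1 ∧ 1 / ((n : ℝ) + 1) ≤ z.im ∧ z.im ≤ n + 1} ∩
      {z : ℂ | 1 / ((n : ℝ) + 1) ≤ z.re ∧ z.re ≤ n + 1 ∧ 0 ≤ z.im ∧ z.im ≤ n + 1} := by
    simp only [mem_inter_iff, mem_setOf_eq, Complex.add_re, Complex.one_re, Complex.I_re, add_zero, abs_one,
      Complex.add_im, Complex.one_im, Complex.I_im, zero_add]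
    refine ⟨⟨by linarith, hinv, by linarith⟩, hinv, by linarith, zero_le_one, by linarith⟩
  have h10 : (1 : ℂ) ∈ {z : ℂ | 1 / ((n : ℝ) + 1) ≤ z.re ∧ z.re ≤ n + 1 ∧ 0 ≤ z.im ∧ z.im ≤ n + 1} ∩ {z : ℂ | z.im ≤ 0} := by
    simp only [mem_inter_iff, mem_setOf_eq, Complex.one_re, Complex.one_im, le_refl, true_and, and_true]
    exact ⟨hinv, by linarith, by linarith⟩
  have h12 : IsConnected ({z : ℂ | |z.re| ≤ n + 1 ∧ 1 / ((n : ℝ) + 1) ≤ z.im ∧ z.im ≤ n + 1} ∪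
      {z : ℂ | 1 / ((n : ℝ) + 1) ≤ z.re ∧ z.re ≤ n + 1 ∧ 0 ≤ z.im ∧ z.im ≤ n + 1}) :=
    IsConnected.union ⟨_, h11⟩ (hc1.isConnected ⟨_, h11.1⟩) (hc2.isConnected ⟨_, h11.2⟩)
  unfold coverRect
  exact IsConnected.union ⟨(1 : ℂ), Or.inr h10.1, h10.2⟩ h12 (hc3.isConnected ⟨_, h10.2⟩)

/-- **`A_n = hpFill R_n` is a `+`-hull.** [folklore] -/
theorem isPlusHull_coverHull (n : ℕ) : IsPlusHull (coverHull n) :=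
  isPlusHull_hpFill (isClosed_coverRect n) (isBounded_coverRect n) (disjoint_coverRect_nonposAxis n)
    (isConnected_coverRect_union n)

/-- `R_n ∩ ℍ ⊆ A_n`. [folklore] -/
theorem coverRect_inter_subset (n : ℕ) : coverRect n ∩ upperHalfPlaneSet ⊆ coverHull n :=
  inter_subset_hpFill _

/-- **Every point of `ℍ̄` off `(−∞, 0]` has a closed disc about it whose part in `ℍ` lies in some
`R_n`.** [folklore] -/
theorem exists_closedBall_inter_subset_coverRect {z : ℂ} (hz : 0 ≤ z.im) (hzn : z ∉ nonposAxis) :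
    ∃ (n : ℕ) (r : ℝ), 0 < r ∧ closedBall z r ∩ upperHalfPlaneSet ⊆ coverRect n := by
  rcases hz.eq_or_lt with him | him
  · -- `z` on the positive axis: the leg
    have hre : 0 < z.re := by
      by_contra h
      exact hzn (mem_nonposAxis_iff.2 ⟨him.symm, not_lt.1 h⟩)
    obtain ⟨n, hn⟩ := exists_nat_ge (max (2 * z.re) (2 / z.re))
    refine ⟨n, z.re / 2, by positivity, ?_⟩
    rintro w ⟨hw, hwH⟩
    rw [Metric.mem_closedBall] at hw
    have hwH' : 0 < w.im := hwH
    have h1 : |w.re - z.re| ≤ z.re / 2 := (abs_re_le_norm (w - z)).trans (by simpa [dist_eq_norm] using hw)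
    have h2 : |w.im - z.im| ≤ z.re / 2 := (abs_im_le_norm (w - z)).trans (by simpa [dist_eq_norm] using hw)
    rw [abs_le] at h1 h2
    have hn1 : 2 * z.re ≤ n := (le_max_left _ _).trans hn
    have hn2 : 2 / z.re ≤ n := (le_max_right _ _).trans hn
    have hn3 : 1 / ((n : ℝ) + 1) ≤ z.re / 2 := by
      rw [div_le_iff₀ (by positivity)]
      rw [div_le_iff₀ hre] at hn2
      nlinarith
    right
    refine ⟨by linarith, by linarith, hwH'.le, ?_⟩
    rw [← him] at h2
    linarith
  · -- `z ∈ ℍ`: the floating rectangle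
    obtain ⟨n, hn⟩ := exists_nat_ge (max (|z.re| + z.im) (max (2 * z.im) (2 / z.im)))
    refine ⟨n, z.im / 2, by positivity, ?_⟩
    rintro w ⟨hw, -⟩
    rw [Metric.mem_closedBall] at hw
    have h1 : |w.re - z.re| ≤ z.im / 2 := (abs_re_le_norm (w - z)).trans (by simpa [dist_eq_norm] using hw)
    have h2 : |w.im - z.im| ≤ z.im / 2 := (abs_im_le_norm (w - z)).trans (by simpa [dist_eq_norm] using hw)
    have hn1 : |z.re| + z.im ≤ n := (le_max_left _ _).trans hn
    have hn2 : 2 * z.im ≤ n := ((le_max_left _ _).trans (le_max_right _ _)).trans hn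
    have hn3 : 2 / z.im ≤ n := ((le_max_right _ _).trans (le_max_right _ _)).trans hn
    have hn4 : 1 / ((n : ℝ) + 1) ≤ z.im / 2 := by
      rw [div_le_iff₀ (by positivity)]
      rw [div_le_iff₀ him] at hn3
      nlinarith
    rw [abs_le] at h2
    left
    refine ⟨?_, by linarith, by linarith⟩
    have := abs_sub_abs_le_abs_sub w.re z.re
    rw [abs_le]
    constructor <;> nlinarith [abs_nonneg w.re, abs_nonneg z.re, h1, neg_abs_le w.re, le_abs_self w.re]

/-- Hence **its part in `ℍ` lies in the `+`-hull `A_n`**. [folklore] -/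
theorem exists_closedBall_inter_subset_coverHull {z : ℂ} (hz : 0 ≤ z.im) (hzn : z ∉ nonposAxis) :
    ∃ (n : ℕ) (r : ℝ), 0 < r ∧ closedBall z r ∩ upperHalfPlaneSet ⊆ coverHull n := by
  obtain ⟨n, r, hr, h⟩ := exists_closedBall_inter_subset_coverRect hz hzn
  exact ⟨n, r, hr, fun w hw ↦ coverRect_inter_subset n ⟨h hw, hw.2⟩⟩

end Cover

/-! ### The hitting event of the cloud and its measurability -/

/-- **The event "the hung set hits `A`"** on the state space, restricted to good parameters:
`{((x, y), a, K) : K ∩ a · m_{x',y'}⁻¹(A) ≠ ∅}` ([Law05] §9.2: "`μ(A)`, `μ` restricted to curves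
that intersect `A`"). [cite: Lawler2005, §9.2 Lemma 9.12 (p. 220)] -/
def hitSet (A : Set ℂ) : Set (((ℝ × ℝ) × ℝ) × RestrictionConfig) :=
  {e | e.1 ∈ goodParams ∧ ¬ Disjoint (e.2 : Set ℂ) (hungHull e.1 A)}

section HitSet

variable {A : Set ℂ}

/-- The hung-hull map `(q, t) ↦ a · m_{x',y'}⁻¹(t)`. [folklore] -/
theorem hungHull_eq_image (q : (ℝ × ℝ) × ℝ) (A : Set ℂ) :
    hungHull q A = (fun t : ℂ ↦ (q.2 : ℂ) * excInv (min q.1.1 q.1.2) (max q.1.1 q.1.2) t) '' A := by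
  unfold hungHull excHull
  ext w
  simp only [Set.mem_smul_set, Set.mem_image, Complex.real_smul]
  constructor
  · rintro ⟨b, ⟨t, ht, rfl⟩, rfl⟩
    exact ⟨t, ht, rfl⟩
  · rintro ⟨t, ht, rfl⟩
    exact ⟨_, ⟨t, ht, rfl⟩, rfl⟩

/-- `q ↦ a · m⁻¹(t)` is measurable in the parameters. [folklore] -/
theorem measurable_hungPoint (t : ℂ) :
    Measurable fun q : (ℝ × ℝ) × ℝ ↦ (q.2 : ℂ) * excInv (min q.1.1 q.1.2) (max q.1.1 q.1.2) t := by
  unfold excInv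
  have h1 : Measurable fun q : (ℝ × ℝ) × ℝ ↦ ((min q.1.1 q.1.2 : ℝ) : ℂ) :=
    Complex.measurable_ofReal.comp ((measurable_fst.comp measurable_fst).min (measurable_snd.comp measurable_fst))
  have h2 : Measurable fun q : (ℝ × ℝ) × ℝ ↦ ((max q.1.1 q.1.2 : ℝ) : ℂ) :=
    Complex.measurable_ofReal.comp ((measurable_fst.comp measurable_fst).max (measurable_snd.comp measurable_fst))
  have h3 : Measurable fun q : (ℝ × ℝ) × ℝ ↦ ((q.2 : ℝ) : ℂ) := Complex.measurable_ofReal.comp measurable_snd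
  exact h3.mul ((h1.sub_const _).div (h2.const_sub _))

/-- For good parameters the hung-hull map is continuous on `A` (a `+`-hull misses the pole
`y' < 0`). [folklore] -/
theorem continuousOn_hungPoint (hA : IsPlusHull A) {q : (ℝ × ℝ) × ℝ} (hq : q ∈ goodParams) :
    ContinuousOn (fun t : ℂ ↦ (q.2 : ℂ) * excInv (min q.1.1 q.1.2) (max q.1.1 q.1.2) t) A := by
  obtain ⟨-, hy, -, -⟩ := goodParams_lt hq
  exact continuousOn_const.mul (continuousOn_excInv (hA.pole_notMem hy))

/-- For good parameters the hung hull is compact. [folklore] -/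
theorem isCompact_hungHull (hA : IsPlusHull A) {q : (ℝ × ℝ) × ℝ} (hq : q ∈ goodParams) : IsCompact (hungHull q A) := by
  rw [hungHull_eq_image]
  exact hA.1.1.isCompact.image_of_continuousOn (continuousOn_hungPoint hA hq)

/-- **A countable subset `A₀ ⊆ A` dense in `A`** (`A` is a subset of the second countable `ℂ`). [folklore] -/
theorem exists_countable_dense_subset (A : Set ℂ) : ∃ A₀ ⊆ A, A₀.Countable ∧ A ⊆ closure A₀ := by
  obtain ⟨D, hDc, hDd⟩ := TopologicalSpace.exists_countable_dense (A : Type)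
  refine ⟨((↑) : A → ℂ) '' D, by rintro _ ⟨t, -, rfl⟩; exact t.2, hDc.image _, fun t ht ↦ ?_⟩
  exact closure_subtype.1 (hDd ⟨t, ht⟩)

/-- On good parameters, the distance from a point to the hung hull is an infimum over a countable
dense subset of `A`. [folklore] -/
theorem infDist_hungHull_eq (hA : IsPlusHull A) (hne : A.Nonempty) {A₀ : Set ℂ} (hA₀ : A₀ ⊆ A)
    (hcl : A ⊆ closure A₀) {q : (ℝ × ℝ) × ℝ} (hq : q ∈ goodParams) (d : ℂ) :
    infDist d (hungHull q A) =
      infDist d ((fun t : ℂ ↦ (q.2 : ℂ) * excInv (min q.1.1 q.1.2) (max q.1.1 q.1.2) t) '' A₀) := by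
  set F := fun t : ℂ ↦ (q.2 : ℂ) * excInv (min q.1.1 q.1.2) (max q.1.1 q.1.2) t with hF
  rw [hungHull_eq_image, ← hF]
  have hA₀ne : A₀.Nonempty := by
    obtain ⟨t, ht⟩ := hne
    exact closure_nonempty_iff.1 ⟨t, hcl ht⟩
  have h1 : F '' A₀ ⊆ F '' A := image_mono hA₀
  have h2 : F '' A ⊆ closure (F '' A₀) := by
    rintro _ ⟨t, ht, rfl⟩
    have hcont : ContinuousWithinAt F A t := continuousOn_hungPoint hA hq t ht
    have ht' : t ∈ closure (A₀ ∩ A) := by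
      rw [inter_eq_left.2 hA₀]
      exact hcl ht
    have := (hcont.mono inter_subset_right).mem_closure_image ht'
    exact closure_mono (image_mono inter_subset_left) this
  apply le_antisymm
  · exact infDist_le_infDist_of_subset h1 (hA₀ne.image F)
  · calc infDist d (F '' A₀) = infDist d (closure (F '' A₀)) := infDist_closure.symm
      _ ≤ infDist d (F '' A) := infDist_le_infDist_of_subset h2 (hne.image F)

/-- The **detection form of "`K` misses the hung hull"**: for good parameters and a nonempty
`+`-hull `A`, `K ∩ a·m⁻¹(A) = ∅` iff for some `m`, every point `d` of a countable dense set is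
either at distance `≥ 1/(m+1)` from the hung hull or the disc `B̄(d, 1/(m+1))` misses `cl K`
(compactness of the hung hull, which misses `cl K = K ∪ {0}`). [folklore] -/
theorem disjoint_hungHull_iff (hA : IsPlusHull A) (hne : A.Nonempty) {D : Set ℂ} (hD : Dense D)
    {q : (ℝ × ℝ) × ℝ} (hq : q ∈ goodParams) (K : RestrictionConfig) :
    Disjoint (K : Set ℂ) (hungHull q A) ↔
      ∃ m : ℕ, ∀ d ∈ D, 1 / ((m : ℝ) + 1) ≤ infDist d (hungHull q A) ∨
        K ∈ RestrictionConfig.missNear d (1 / ((m : ℝ) + 1)) := by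
  have hH := isCompact_hungHull hA hq
  have hHne : (hungHull q A).Nonempty := by
    rw [hungHull_eq_image]
    exact hne.image _
  have hstar := isStarHull_hungHull hA hq
  constructor
  · intro hdisj
    -- `hungHull` misses the closed set `cl K = K ∪ {0}`
    have hsub : hungHull q A ⊆ (closure (K : Set ℂ))ᶜ := by
      intro w hw hwcl
      rw [K.closure_eq_union_zero] at hwcl
      rcases hwcl with h | h
      · exact Set.disjoint_left.1 hdisj h hw
      · rw [mem_singleton_iff] at h
        exact hstar.2 (h ▸ hw)
    obtain ⟨δ, hδ, hδsub⟩ := hH.exists_cthickening_subset_open isClosed_closure.isOpen_compl hsub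
    obtain ⟨m, hm⟩ := exists_nat_one_div_lt (half_pos hδ)
    refine ⟨m, fun d _ ↦ ?_⟩
    by_cases hd : 1 / ((m : ℝ) + 1) ≤ infDist d (hungHull q A)
    · exact Or.inl hd
    · right
      refine RestrictionConfig.mem_missNear_of_disjoint (by positivity) (Set.disjoint_left.2 fun u hu hucl ↦ ?_)
      -- `u` is `δ`-close to the hung hull, hence off `cl K`
      have hud : dist u d ≤ 1 / ((m : ℝ) + 1) := mem_closedBall.1 hu
      have h1 : infDist d (hungHull q A) < 1 / ((m : ℝ) + 1) := not_le.1 hd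
      obtain ⟨w, hw, hdw⟩ := (infDist_lt_iff hHne).1 h1
      have huw : dist u w ≤ δ := by
        calc dist u w ≤ dist u d + dist d w := dist_triangle _ _ _
          _ ≤ 1 / ((m : ℝ) + 1) + 1 / ((m : ℝ) + 1) := by linarith [hdw.le]
          _ ≤ δ := by linarith
      exact hδsub (mem_cthickening_of_dist_le u w δ _ hw huw) hucl
  · rintro ⟨m, hm⟩
    refine Set.disjoint_left.2 fun b hbK hbH ↦ ?_
    have hpos : (0 : ℝ) < 1 / ((m : ℝ) + 1) := by positivity
    obtain ⟨d, hdD, hdb⟩ : ∃ d ∈ D, dist b d < 1 / ((m : ℝ) + 1) := by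
      have := hD.exists_dist_lt b hpos
      obtain ⟨d, hd, h⟩ := this
      exact ⟨d, hd, h⟩
    rcases hm d hdD with h | h
    · have : infDist d (hungHull q A) ≤ dist d b := infDist_le_dist_of_mem hbH
      rw [dist_comm] at hdb
      linarith
    · exact Set.disjoint_left.1 (RestrictionConfig.disjoint_closedBall_of_mem_missNear h) hbK
        (mem_closedBall.2 hdb.le)

/-- **The hitting event is measurable** in the product σ-field (countably many measurable
rectangles detect its complement, `disjoint_hungHull_iff`). [folklore] -/
theorem measurableSet_hitSet (hA : IsPlusHull A) (hne : A.Nonempty) : MeasurableSet (hitSet A) := by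
  obtain ⟨D, hDc, hDd⟩ := TopologicalSpace.exists_countable_dense ℂ
  obtain ⟨A₀, hA₀, hA₀c, hcl⟩ := exists_countable_dense_subset A
  have hA₀ne : A₀.Nonempty := by
    obtain ⟨t, ht⟩ := hne
    exact closure_nonempty_iff.1 ⟨t, hcl ht⟩
  set F : (ℝ × ℝ) × ℝ → ℂ → ℂ := fun q t ↦ (q.2 : ℂ) * excInv (min q.1.1 q.1.2) (max q.1.1 q.1.2) t with hF
  -- the parameter sets "far from `d`" and the configuration sets "missing the disc about `d`"
  set T : ℕ → ℂ → Set ((ℝ × ℝ) × ℝ) := fun m d ↦ {q | ∀ t ∈ A₀, 1 / ((m : ℝ) + 1) ≤ dist d (F q t)} with hT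
  set M : ℕ → ℂ → Set RestrictionConfig := fun m d ↦ RestrictionConfig.missNear d (1 / ((m : ℝ) + 1)) with hM
  have hTmeas : ∀ m d, MeasurableSet (T m d) := by
    intro m d
    have : T m d = ⋂ t ∈ A₀, {q | 1 / ((m : ℝ) + 1) ≤ dist d (F q t)} := by
      ext q
      simp [hT]
    rw [this]
    exact MeasurableSet.biInter hA₀c fun t _ ↦
      measurableSet_le measurable_const (measurable_const.dist (measurable_hungPoint t))
  have hTiff : ∀ q ∈ goodParams, ∀ m d, q ∈ T m d ↔ 1 / ((m : ℝ) + 1) ≤ infDist d (hungHull q A) := by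
    intro q hq m d
    rw [infDist_hungHull_eq hA hne hA₀ hcl hq d, le_infDist (hA₀ne.image _)]
    simp only [hT, mem_setOf_eq, forall_mem_image]
    exact Iff.rfl
  -- the decomposition of the hitting event
  have hdec : hitSet A = (goodParams ×ˢ univ) ∩
      (⋃ m : ℕ, ⋂ d ∈ D, (T m d ×ˢ univ ∪ univ ×ˢ M m d))ᶜ := by
    ext ⟨q, K⟩
    simp only [hitSet, mem_setOf_eq, mem_inter_iff, mem_prod, mem_univ, and_true, mem_compl_iff, mem_iUnion,
      mem_iInter, mem_union, true_and, not_exists, not_forall]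
    constructor
    · rintro ⟨hq, hnd⟩
      refine ⟨hq, fun m ↦ ?_⟩
      by_contra hall
      push Not at hall
      refine hnd ((disjoint_hungHull_iff hA hne hDd hq K).2 ⟨m, fun d hd ↦ ?_⟩)
      rcases hall d hd with h | h
      · exact Or.inl ((hTiff q hq m d).1 h)
      · exact Or.inr h
    · rintro ⟨hq, hall⟩
      refine ⟨hq, fun hdisj ↦ ?_⟩
      obtain ⟨m, hm⟩ := (disjoint_hungHull_iff hA hne hDd hq K).1 hdisj
      obtain ⟨d, hd, h⟩ := hall m
      rcases hm d hd with h' | h'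
      · exact h (Or.inl ((hTiff q hq m d).2 h'))
      · exact h (Or.inr h')
  rw [hdec]
  refine (measurableSet_goodParams.prod MeasurableSet.univ).inter (MeasurableSet.compl ?_)
  refine MeasurableSet.iUnion fun m ↦ MeasurableSet.biInter hDc fun d _ ↦ ?_
  exact ((hTmeas m d).prod MeasurableSet.univ).union
    (MeasurableSet.univ.prod (RestrictionConfig.measurableSet_missNear d _))

/-- The section of the hitting event at good parameters is the complement of an avoidance event. [folklore] -/
theorem prodMk_preimage_hitSet_of_mem {q : (ℝ × ℝ) × ℝ} (hq : q ∈ goodParams) (A : Set ℂ) :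
    Prod.mk q ⁻¹' hitSet A = (RestrictionConfig.avoid (hungHull q A))ᶜ := by
  ext K
  simp [hitSet, hq]

/-- The section of the hitting event at bad parameters is empty. [folklore] -/
theorem prodMk_preimage_hitSet_of_notMem {q : (ℝ × ℝ) × ℝ} (hq : q ∉ goodParams) (A : Set ℂ) :
    Prod.mk q ⁻¹' hitSet A = ∅ := by
  ext K
  simp [hitSet, hq]

end HitSet

/-! ### The intensity `Λ_β = [β (x − y)⁻² dx dy] ⊗ [da] ⊗ P` of the cloud -/

section Intensity

/-- The density `β (x − y)⁻²` of the feet ([Law05] §9.2: "`c ∫∫ μ^#_ℍ(x₁, x₂) |x₁ − x₂|⁻¹ dx₁ dx₂`"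
— the printed exponent `−1` is a misprint for `−2`, the total mass `H_ℍ(x₁, x₂)` of `μ_ℍ(x₁, x₂)`
being `c (x₁ − x₂)⁻²`, cf. ibid. §5.2). [cite: Lawler2005, §9.2 (p. 220)] -/
def feetDensity (β : ℝ) (p : ℝ × ℝ) : ℝ≥0∞ := ENNReal.ofReal (β * ((p.1 - p.2) ^ 2)⁻¹)

/-- **The measure `β (x − y)⁻² dx dy` on the feet square `(−∞, 0)²`.** [cite: Lawler2005, §9.2 (p. 220)] -/
def feetMeasure (β : ℝ) : Measure (ℝ × ℝ) := (volume.restrict feetSquare).withDensity (feetDensity β)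

/-- The parameter measure: feet and a uniform dilation parameter `a ∈ (0, 1)`. [folklore] -/
def paramMeasure (β : ℝ) : Measure ((ℝ × ℝ) × ℝ) := (feetMeasure β).prod (volume.restrict (Ioo (0 : ℝ) 1))

/-- **The intensity of the cloud of exponent `β` with sample law `P`** ([Law05] §9.2:
"`μ = ∫∫ μ_ℍ(x₁, x₂) dx₁ dx₂`" with a Poissonian realization of `λμ`):
`Λ_β = [β (x − y)⁻² dx dy on (−∞,0)²] ⊗ [da on (0,1)] ⊗ P`. [cite: Lawler2005, §9.2 Prop. 9.13 (p. 220)] -/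
def cloudIntensity (β : ℝ) (P : Measure RestrictionConfig) : Measure (((ℝ × ℝ) × ℝ) × RestrictionConfig) :=
  (paramMeasure β).prod P

/-- The feet density is measurable. [folklore] -/
theorem measurable_feetDensity (β : ℝ) : Measurable (feetDensity β) := by
  unfold feetDensity
  fun_prop

/-- The feet measure is s-finite. [folklore] -/
instance (β : ℝ) : SFinite (feetMeasure β) := by
  unfold feetMeasure; infer_instance

/-- The parameter measure is s-finite. [folklore] -/
instance (β : ℝ) : SFinite (paramMeasure β) := by
  unfold paramMeasure; infer_instance

/-- The cloud intensity is s-finite (Kingman's hypothesis). [folklore] -/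
instance (β : ℝ) (P : Measure RestrictionConfig) [SFinite P] : SFinite (cloudIntensity β P) := by
  unfold cloudIntensity; infer_instance

/-- The feet measure lives on the feet square. [folklore] -/
theorem feetMeasure_compl_feetSquare (β : ℝ) : feetMeasure β feetSquareᶜ = 0 := by
  rw [feetMeasure]
  exact withDensity_absolutelyContinuous _ _ (by simp [Measure.restrict_apply measurableSet_feetSquare.compl])

/-- The diagonal is Lebesgue-null in `ℝ²`. [folklore] -/
theorem volume_diagonal_real : volume {p : ℝ × ℝ | p.1 = p.2} = 0 := by
  have hmeas : MeasurableSet {p : ℝ × ℝ | p.1 = p.2} := measurableSet_eq_fun measurable_fst measurable_snd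
  rw [Measure.volume_eq_prod, Measure.prod_apply hmeas]
  have : ∀ x : ℝ, volume (Prod.mk x ⁻¹' {p : ℝ × ℝ | p.1 = p.2}) = 0 := fun x ↦ by
    have : Prod.mk x ⁻¹' {p : ℝ × ℝ | p.1 = p.2} = {x} := by
      ext y
      simp [eq_comm]
    rw [this, measure_singleton]
  calc ∫⁻ x, volume (Prod.mk x ⁻¹' {p : ℝ × ℝ | p.1 = p.2}) = ∫⁻ _ : ℝ, (0 : ℝ≥0∞) := lintegral_congr this
    _ = 0 := lintegral_zero

/-- The feet measure does not charge the diagonal. [folklore] -/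
theorem feetMeasure_diagonal (β : ℝ) : feetMeasure β {p : ℝ × ℝ | p.1 = p.2} = 0 := by
  have hmeas : MeasurableSet {p : ℝ × ℝ | p.1 = p.2} := measurableSet_eq_fun measurable_fst measurable_snd
  rw [feetMeasure]
  refine withDensity_absolutelyContinuous _ _ ?_
  rw [Measure.restrict_apply hmeas]
  exact measure_mono_null inter_subset_left volume_diagonal_real

/-- **The parameter measure lives on the good parameters.** [folklore] -/
theorem paramMeasure_compl_goodParams (β : ℝ) : paramMeasure β goodParamsᶜ = 0 := by
  have hsub : goodParamsᶜ ⊆ (feetSquareᶜ ×ˢ (univ : Set ℝ)) ∪ ({p : ℝ × ℝ | p.1 = p.2} ×ˢ (univ : Set ℝ)) ∪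
      ((univ : Set (ℝ × ℝ)) ×ˢ (Ioo (0 : ℝ) 1)ᶜ) := by
    intro q hq
    simp only [goodParams, mem_setOf_eq, not_and, mem_compl_iff] at hq
    simp only [mem_union, mem_prod, mem_compl_iff, mem_univ, and_true, mem_setOf_eq, true_and]
    by_cases h1 : q.1 ∈ feetSquare
    · by_cases h2 : q.1.1 = q.1.2
      · exact Or.inl (Or.inr h2)
      · exact Or.inr (hq h1 h2)
    · exact Or.inl (Or.inl h1)
  refine measure_mono_null hsub (measure_union_null (measure_union_null ?_ ?_) ?_)
  · rw [paramMeasure, Measure.prod_prod, feetMeasure_compl_feetSquare, zero_mul]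
  · rw [paramMeasure, Measure.prod_prod, feetMeasure_diagonal, zero_mul]
  · rw [paramMeasure, Measure.prod_prod, Measure.restrict_apply measurableSet_Ioo.compl]
    simp

/-- The cloud intensity of a rectangle. [folklore] -/
theorem cloudIntensity_prod (β : ℝ) (P : Measure RestrictionConfig) [SFinite P] (s : Set ((ℝ × ℝ) × ℝ))
    (E : Set RestrictionConfig) : cloudIntensity β P (s ×ˢ E) = paramMeasure β s * P E := by
  rw [cloudIntensity, Measure.prod_prod]

/-- **The intensity has no atoms** (the dilation parameter is diffuse). [folklore] -/
theorem cloudIntensity_singleton (β : ℝ) (P : Measure RestrictionConfig) [SFinite P]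
    (e : ((ℝ × ℝ) × ℝ) × RestrictionConfig) : cloudIntensity β P {e} = 0 := by
  rw [cloudIntensity, ← Set.singleton_prod_singleton, Measure.prod_prod, paramMeasure,
    ← Set.singleton_prod_singleton, Measure.prod_prod, Measure.restrict_apply (measurableSet_singleton _)]
  have : volume ({e.1.2} ∩ Ioo (0 : ℝ) 1) = 0 := measure_mono_null inter_subset_left (by simp)
  rw [this]
  simp

end Intensity

/-! ### `Λ_β(hit A) = β · (−log Φ'_A(0))` ([Law05] Lemma 9.12, with the constant) -/

section HitMass

variable {A : Set ℂ} (hA : IsPlusHull A) (hne : A.Nonempty)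
include hA hne

/-- **The avoidance probability of the hung hull** `a · m_{x',y'}⁻¹(A)` under a two-sided
restriction measure: `P_α[K ∩ a·m⁻¹(A) = ∅] = Φ'_{m⁻¹(A)}(0)^α` (`Φ'_{aB}(0) = Φ'_B(0)`, [LSW]
p. 11). [cite: LawlerSchrammWerner2003Restriction, Prop. 3.3 (3) with its proof (p. 11, Φ'_{λA}(0) = Φ'_A(0))] -/
theorem IsRestrictionMeasure.measure_avoid_hungHull {α : ℝ} {P : Measure RestrictionConfig}
    (hP : IsRestrictionMeasure α P) {q : (ℝ × ℝ) × ℝ} (hq : q ∈ goodParams) :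
    P (RestrictionConfig.avoid (hungHull q A)) =
      ENNReal.ofReal (hA.excDeriv hne (min q.1.1 q.1.2) (max q.1.1 q.1.2) ^ α) := by
  obtain ⟨hxy, hy, ha, -⟩ := goodParams_lt hq
  exact hP.2 (isStarHull_hungHull hA hq) ((hA.isRestrictionMap_excRestrictionMap hne hxy hy).smulHull ha)
    ((hA.hasRestrictionDeriv_excRestrictionMap hne hxy hy).smulHull ha)

/-- `excDeriv (min x y) (max x y) = excDeriv x y` (symmetry). [folklore] -/
theorem IsPlusHull.excDeriv_min_max (x y : ℝ) :
    hA.excDeriv hne (min x y) (max x y) = hA.excDeriv hne x y := by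
  rcases le_total x y with h | h
  · rw [min_eq_left h, max_eq_right h]
  · rw [min_eq_right h, max_eq_left h, hA.excDeriv_comm hne]

/-- `excDeriv` is a.e.-measurable on the feet square (it agrees there with a measurable
expression in `E_A'` and the cut-off real trace). [folklore] -/
theorem IsPlusHull.aemeasurable_excDeriv :
    AEMeasurable (fun p : ℝ × ℝ ↦ hA.excDeriv hne p.1 p.2) (volume.restrict feetSquare) := by
  have hd : Measurable fun t : ℝ ↦ (deriv (hA.extMap hne) t).re :=
    Complex.measurable_re.comp ((measurable_deriv (hA.extMap hne)).comp Complex.measurable_ofReal)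
  have ht : Measurable (hA.excTrace hne) := hA.measurable_excTrace hne
  have hg : Measurable fun p : ℝ × ℝ ↦ (deriv (hA.extMap hne) p.1).re * (deriv (hA.extMap hne) p.2).re *
      (p.2 - p.1) ^ 2 / (hA.excTrace hne p.2 - hA.excTrace hne p.1) ^ 2 :=
    (((hd.comp measurable_fst).mul (hd.comp measurable_snd)).mul ((measurable_snd.sub measurable_fst).pow_const 2)).div
      (((ht.comp measurable_snd).sub (ht.comp measurable_fst)).pow_const 2)
  refine hg.aemeasurable.congr ((ae_restrict_iff' measurableSet_feetSquare).2 (ae_of_all _ fun p hp ↦ ?_))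
  have hε := hA.half_leftPt_pos hne
  simp only [IsPlusHull.excDeriv]
  rw [hA.excTrace_of_lt hne ((mem_Iio.1 hp.1).trans hε), hA.excTrace_of_lt hne ((mem_Iio.1 hp.2).trans hε)]

/-- The sections of the hitting event. [folklore] -/
theorem measure_prodMk_preimage_hitSet {P : Measure RestrictionConfig} (hP : IsRestrictionMeasure 1 P)
    (q : (ℝ × ℝ) × ℝ) :
    P (Prod.mk q ⁻¹' hitSet A) = goodParams.indicator (fun q ↦ ENNReal.ofReal (1 - hA.excDeriv hne q.1.1 q.1.2)) q := by
  haveI := hP.isProbabilityMeasure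
  by_cases hq : q ∈ goodParams
  · obtain ⟨hxy, hy, -, -⟩ := goodParams_lt hq
    rw [indicator_of_mem hq, prodMk_preimage_hitSet_of_mem hq,
      prob_compl_eq_one_sub (RestrictionConfig.measurableSet_avoid (isStarHull_hungHull hA hq)),
      hP.measure_avoid_hungHull hA hne hq, Real.rpow_one, hA.excDeriv_min_max hne,
      ENNReal.ofReal_sub _ (hA.excDeriv_min_max hne q.1.1 q.1.2 ▸ (hA.excDeriv_pos hne hxy hy).le), ENNReal.ofReal_one]
  · rw [indicator_of_notMem hq, prodMk_preimage_hitSet_of_notMem hq, measure_empty]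

/-- **`Λ_β(hit A) = β · (−log Φ'_A(0))`** for a nonempty `+`-hull `A`, a two-sided restriction
measure `P` of exponent `1` and `β ≥ 0` ([Law05] Lemma 9.12, `|μ(A)| < ∞`, with the constant
identified: the `P`-probability that the hung sample hits `A` is `1 − Φ'_{m⁻¹(A)}(0)`, integrated
by the mass identity `IsPlusHull.setLIntegral_prod_one_sub_excDeriv`).
[cite: Lawler2005, §9.2 Lemma 9.12 (p. 220)] -/
theorem cloudIntensity_hitSet {P : Measure RestrictionConfig} (hP : IsRestrictionMeasure 1 P) {β : ℝ} (hβ : 0 ≤ β)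
    {Φ : ConformalEquiv (upperHalfPlaneSet \ A) upperHalfPlaneSet} (hΦ : IsRestrictionMap A Φ) {d : ℝ}
    (hd : HasRestrictionDeriv A Φ d) :
    cloudIntensity β P (hitSet A) = ENNReal.ofReal (β * (-Real.log d)) := by
  haveI := hP.isProbabilityMeasure
  set F : ℝ × ℝ → ℝ≥0∞ := fun p ↦ ENNReal.ofReal (1 - hA.excDeriv hne p.1 p.2) with hF
  have hFae : AEMeasurable F (volume.restrict feetSquare) := by
    have h := hA.aemeasurable_excDeriv hne
    exact ENNReal.measurable_ofReal.comp_aemeasurable (h.const_sub 1)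
  have hFfeet : AEMeasurable F (feetMeasure β) := hFae.mono' (withDensity_absolutelyContinuous _ _)
  rw [cloudIntensity, Measure.prod_apply (measurableSet_hitSet hA hne),
    lintegral_congr (measure_prodMk_preimage_hitSet hA hne hP), lintegral_indicator measurableSet_goodParams,
    Measure.restrict_congr_set (ae_eq_univ.2 (paramMeasure_compl_goodParams β)), Measure.restrict_univ]
  -- integrate out the dilation parameter
  have h1 : ∫⁻ q, ENNReal.ofReal (1 - hA.excDeriv hne q.1.1 q.1.2) ∂paramMeasure β = ∫⁻ p, F p ∂feetMeasure β := by
    rw [paramMeasure, lintegral_prod _ hFfeet.comp_fst]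
    refine lintegral_congr fun p ↦ ?_
    show ∫⁻ _ in Ioo (0 : ℝ) 1, F p ∂volume = F p
    rw [lintegral_const, Measure.restrict_apply_univ, Real.volume_Ioo]
    simp
  rw [h1, feetMeasure, lintegral_withDensity_eq_lintegral_mul₀ (measurable_feetDensity β).aemeasurable hFae]
  -- the density times the hitting probability is `β` times the excursion kernel
  have h2 : ∀ p ∈ feetSquare, (feetDensity β * F) p =
      ENNReal.ofReal β * ENNReal.ofReal (((p.1 - p.2) ^ 2)⁻¹ * (1 - hA.excDeriv hne p.1 p.2)) := by
    intro p _
    simp only [Pi.mul_apply, feetDensity, hF]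
    rw [ENNReal.ofReal_mul hβ, ENNReal.ofReal_mul (inv_nonneg.2 (sq_nonneg _)), mul_assoc]
  rw [setLIntegral_congr_fun measurableSet_feetSquare h2, lintegral_const_mul' _ _ ENNReal.ofReal_ne_top,
    show feetSquare = Iio (0 : ℝ) ×ˢ Iio (0 : ℝ) from rfl, hA.setLIntegral_prod_one_sub_excDeriv hne hΦ hd,
    ← ENNReal.ofReal_mul hβ]

/-- In particular `Λ_β(hit A) < ∞` ([Law05] Lemma 9.12). [cite: Lawler2005, §9.2 Lemma 9.12 (p. 220)] -/
theorem cloudIntensity_hitSet_ne_top {P : Measure RestrictionConfig} (hP : IsRestrictionMeasure 1 P) {β : ℝ}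
    (hβ : 0 ≤ β) : cloudIntensity β P (hitSet A) ≠ ∞ := by
  obtain ⟨Φ, hΦ, -⟩ := IsStarHull.existsUnique_isRestrictionMap_holds hA.1
  obtain ⟨d, -, -, hd⟩ := IsStarHull.exists_hasRestrictionDeriv_holds hA.1 hΦ
  rw [cloudIntensity_hitSet hA hne hP hβ hΦ hd]
  exact ENNReal.ofReal_ne_top

end HitMass

end Literature.Probability.RandomPlanarGeometry

end
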